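import Summits.HodgeConjecture.CorCM.Census.DecicWeil23Pair
import HarnessLib

/-!
# THREE `(2,3)`-types over one DECIC CM field `K ⊇ k` with `3`-transitive quintic part: `E × B₁ × B₂ × B₃` — the balanced
# weights of every product of copies are conjugate pairs, Weil SIXFOLD `6`-sets of `B_m × E` and the TENFOLD `10`-sets of
# `B_m × B̄_{m'}` (kernel census, 32-point model, eight shapes)

COR-CM (cell `pub-hodgecm2`), seat b30 gen 22 (2026-08-22); count-neutral own lane DECIC-WEIL-23PAIR, part TRIPLE (the sequel of
`Census/DecicWeil23Pair`: THREE distinct types at once — the largest number for which the census is clean in every configuration;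
FOUR distinct types fail on the `25` «triangle + complement» configurations and FIVE or more always fail).  Bookkeeping definitions
and theorems of a finite model; no named fact, no geometry, no `sorry`.  The `A₅` table `permD` of `Census/DecicWeil23Pair` is reused
BY NAME.

SETTING (formalised downstream, `CorCM/DecicWeil23TripleFrameTransfer`).  `K ⊇ i(k)` a CM field of degree `10`, `τ : k → ℂ`, a frame
`e : Hom(K, ℂ) ≃ Fin 5 × Bool`; three CM types of `k`-signature `(2,3)` read as `s ∈ Φ_m ⟺ (e s).2 = [(e s).1 ∈ posT c m]` for one of the
EIGHT SHAPES `c` (`posT`): every ordered triple of distinct `2`-subsets of the five pairs is an ordered triple of distinct edges of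
`K₅` — a triangle, a star, a path (three orders) or a vee plus a disjoint edge (three orders) — and is brought to the shape's normal
position by relabeling the frame (a permutation of `S₅`).  THE GALOIS INPUT: every EVEN permutation of the five pairs is induced by
an automorphism of `ℂ` fixing `τ` (`3`-transitivity).

MODEL.  `PtT = Bool ⊕ (Fin 3 × (Fin 5 × Bool))`; `phiT c r = {inl true} ⊔ {inr (m, (a, b)) | b = [permD r a ∈ posT c m]}`;
`ModelBalancedT c v T`: the sixty equations `2 · #{x ∈ T | v x ∈ phiT c r} = |T|`.

RESULTS (kernel).  `phiT_isCMType`, `phiT_eq`, counting lemmas and the signed form `balancedT_iff_signed` of the `r`-th equation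
(`e + Σ_{m,a} ± d_{m,a} = 0`).  THE DEFECT LAW (`d_{m,a} = d_{m,0}`, `e = d_{0,0} + d_{1,0} + d_{2,0}` for all eight shapes) is the
sequel `Census/DecicWeil23TripleDefect.lean`; parts, extraction and induction follow in `Census/DecicWeil23TripleParts` /
`…Extraction`.
[cite: Pohlmann1968, Thm 1] [cite: GaoUllmo2025, Thm 3.1] [cite: MoonenZarhin1995Duke, Thm. 2.4] [cite: Gordon1999HodgeAVSurvey, 5.13 (ii), 9.2.2]

## References
* [Pohlmann1968] H. Pohlmann, Ann. of Math. 88 (1968), Thm 1.  [GaoUllmo2025] Z. Gao, E. Ullmo, J. Inst. Math. Jussieu 25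
  (2025), Thm 3.1.  [MoonenZarhin1995Duke] B. Moonen, Yu. Zarhin, Duke Math. J. 77 (1995), Thm. 2.4.  [Gordon1999HodgeAVSurvey]
  B. B. Gordon, CRM Monogr. 10 (1999), 5.13 (ii), 9.2.2.

## Provenance
Exact python first (seat folder `work/scratch/triple.py`, `multi_types.py`): rank `13` of the sixty signed equations in the `16`
unknowns for each of the eight shapes (all `120` unordered triples of distinct `2`-subsets are clean under `A₅` and `S₅`); the
thirteen listed rows already have rank `13` for every shape; every ordered triple is covered by a shape under `permD r` or
`(3 4) ∘ permD r`.
-/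

namespace Summit.HodgeConjecture.CorCM.Census.DecicWeil23Triple

open Finset
open Summit.HodgeConjecture.CorCM.Census.DecicWeil23Pair (permD permD_facts)

/-! ### The model -/

/-- Points: `inl b` = embedding of `k` of sign `b`; `inr (m, (a, b))` = embedding of `K` of sign `b` in the pair `a` on a factor
of type `m`. [cite: GaoUllmo2025, §2.1] -/
abbrev PtT : Type := Bool ⊕ (Fin 3 × (Fin 5 × Bool))

/-- Complex conjugation on the model: the sign flips. [folklore] -/
def cjT : PtT → PtT
  | Sum.inl b => Sum.inl (!b)
  | Sum.inr (m, (a, b)) => Sum.inr (m, (a, !b))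

/-- Unfolding of `cjT`, curve slot. [folklore] -/
theorem cjT_inl (b : Bool) : cjT (Sum.inl b) = Sum.inl (!b) := rfl

/-- Unfolding of `cjT`, fivefold slots. [folklore] -/
theorem cjT_inr (m : Fin 3) (a : Fin 5) (b : Bool) : cjT (Sum.inr (m, (a, b))) = Sum.inr (m, (a, !b)) := rfl

/-- `cjT` is a fixed-point-free involution. [folklore] -/
theorem cjT_facts : (∀ y : PtT, cjT (cjT y) = y) ∧ ∀ y : PtT, cjT y ≠ y := by
  refine ⟨by decide +kernel, by decide +kernel⟩

/-- **The eight SHAPES of three distinct positions** (ordered triples of distinct `2`-subsets of the five pairs, one per orbit of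
`S₅` = per isomorphism class of an ordered triple of distinct edges of `K₅`): `0` triangle `(01, 12, 02)`; `1` star
`(01, 02, 03)`; `2, 3, 4` path `(01, 12, 23)`, `(12, 01, 23)`, `(01, 23, 12)` (middle edge second / first / third); `5, 6, 7` vee +
disjoint edge `(01, 12, 34)`, `(01, 34, 12)`, `(34, 01, 12)`.  `posT c m` = the two pairs of slot `m` in shape `c`. [folklore] -/
def posT : Fin 8 → Fin 3 → Fin 5 × Fin 5 :=
  ![![(0, 1), (1, 2), (0, 2)], ![(0, 1), (0, 2), (0, 3)], ![(0, 1), (1, 2), (2, 3)], ![(1, 2), (0, 1), (2, 3)],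
    ![(0, 1), (2, 3), (1, 2)], ![(0, 1), (1, 2), (3, 4)], ![(0, 1), (3, 4), (1, 2)], ![(3, 4), (0, 1), (1, 2)]]

/-- `inPosT c m b = [b ∈ posT c m]`: the position indicator of the type of slot `m` in shape `c`. [folklore] -/
def inPosT (c : Fin 8) (m : Fin 3) (b : Fin 5) : Bool :=
  decide (b = (posT c m).1 ∨ b = (posT c m).2)

/-- `signTabT c r m a = [permD r a ∈ I_m]`: whether the label `(a, true)` of a factor of type `m` lies in `ρ_r⁻¹Φ_m`. [folklore] -/
def signTabT (c : Fin 8) (r : Fin 60) (m : Fin 3) (a : Fin 5) : Bool := inPosT c m (permD r a)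

/-- Row `0` is the identity: `signTabT c 0 m a = inPosT c m a`. [folklore] -/
theorem signTabT_zero (c : Fin 8) (m : Fin 3) (a : Fin 5) : signTabT c 0 m a = inPosT c m a := by
  rw [signTabT, permD_facts.2.2, id]

/-- All three types have `k`-signature `(2,3)`: exactly two of the five pairs carry the sign `true`. [folklore] -/
theorem card_inPosT (c : Fin 8) (m : Fin 3) : ((univ : Finset (Fin 5)).filter fun a => inPosT c m a = true).card = 2 := by
  revert c m; unfold inPosT posT; decide +kernel

/-- The three types of a shape are pairwise distinct (as position sets). [folklore] -/
theorem inPosT_injective (c : Fin 8) : Function.Injective (inPosT c) := by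
  revert c; unfold inPosT posT; decide +kernel

/-- **`ρ_r⁻¹(type)` read in the model** (Boolean form). [cite: GaoUllmo2025, Thm 3.1 (3.2)] -/
def inPhiT (c : Fin 8) (r : Fin 60) : PtT → Bool
  | Sum.inl b => b
  | Sum.inr (m, (a, b)) => b == signTabT c r m a

/-- `ρ_r⁻¹(type)` as a finset of the model. [cite: GaoUllmo2025, Thm 3.1 (3.2)] -/
def phiT (c : Fin 8) (r : Fin 60) : Finset PtT := univ.filter fun y => inPhiT c r y = true

/-- Membership, curve slot. [folklore] -/
theorem inl_mem_phiT (c : Fin 8) (r : Fin 60) (b : Bool) : Sum.inl b ∈ phiT c r ↔ b = true := by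
  simp [phiT, inPhiT]

/-- Membership, fivefold slots. [folklore] -/
theorem inr_mem_phiT (c : Fin 8) (r : Fin 60) (m : Fin 3) (a : Fin 5) (b : Bool) :
    Sum.inr (m, (a, b)) ∈ phiT c r ↔ b = signTabT c r m a := by
  simp [phiT, inPhiT]

/-- Each `phiT c r` is a CM type of the model (exactly one of `y`, `cjT y`; sixteen points). [folklore] -/
theorem phiT_isCMType : ∀ (c : Fin 8) (r : Fin 60), (∀ y : PtT, (y ∈ phiT c r ↔ cjT y ∉ phiT c r)) ∧ (phiT c r).card = 16 := by
  unfold phiT inPhiT signTabT inPosT posT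
  decide +kernel

/-- `phiT c r` as an explicit finset: `{inl true} ⊔ {inr (m, (a, signTabT c r m a))}`. [folklore] -/
theorem phiT_eq (c : Fin 8) (r : Fin 60) : phiT c r =
    insert (Sum.inl true) ((univ : Finset (Fin 3 × Fin 5)).image fun q => (Sum.inr (q.1, (q.2, signTabT c r q.1 q.2)) : PtT)) := by
  revert c r
  unfold phiT inPhiT
  decide +kernel

/-! ### Balanced configurations -/

variable {α : Type*}

/-- **Pohlmann's condition for a configuration** of a product of copies of `E, B₁, B₂, B₃` under `A₅`-realisation: the sixty
equations `2 · #{x ∈ T | v x ∈ ρ_r⁻¹(type)} = |T|`. [cite: GaoUllmo2025, Thm 3.1 eq. (3.2)] [cite: Pohlmann1968, Thm 1] -/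
def ModelBalancedT (c : Fin 8) (v : α → PtT) (T : Finset α) : Prop :=
  ∀ r : Fin 60, 2 * (T.filter fun x => v x ∈ phiT c r).card = T.card

variable (c : Fin 8) (v : α → PtT)

/-- The empty configuration is balanced. [folklore] -/
theorem modelBalancedT_empty : ModelBalancedT c v (∅ : Finset α) := fun _ => by simp

variable {c v}

/-- **Removing a balanced part keeps the balance.** [folklore] -/
theorem ModelBalancedT.sdiff [DecidableEq α] {T G : Finset α} (hT : ModelBalancedT c v T) (hG : ModelBalancedT c v G)
    (hGT : G ⊆ T) : ModelBalancedT c v (T \ G) := by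
  intro r
  have key : ∀ (Q : α → Prop) [DecidablePred Q],
      ((T \ G).filter Q).card = (T.filter Q).card - (G.filter Q).card := by
    intro Q _
    rw [← Finset.card_sdiff_of_subset (Finset.filter_subset_filter Q hGT)]
    congr 1
    ext x
    simp only [Finset.mem_filter, Finset.mem_sdiff]
    tauto
  have h1 := hT r
  have h2 := hG r
  have h3 := Finset.card_sdiff_of_subset hGT
  have h4 : (G.filter fun x => v x ∈ phiT c r).card ≤ (T.filter fun x => v x ∈ phiT c r).card :=
    Finset.card_le_card (Finset.filter_subset_filter _ hGT)
  rw [key, h3]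
  omega

/-! ### Counting fibrewise; the signed form -/

variable (v)

/-- `#{x ∈ T | v x ∈ W} = Σ_{y ∈ W} #{x ∈ T | v x = y}`. [folklore] -/
theorem card_filter_mem_eq_sumT (T : Finset α) (W : Finset PtT) :
    (T.filter fun x => v x ∈ W).card = ∑ y ∈ W, (T.filter fun x => v x = y).card := by
  rw [Finset.card_eq_sum_card_fiberwise (f := v) (s := T.filter fun x => v x ∈ W) (t := W)
    (fun x hx => (Finset.mem_filter.1 (Finset.mem_coe.1 hx)).2)]
  refine Finset.sum_congr rfl fun y hy => ?_
  congr 1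
  ext x
  simp only [Finset.mem_filter]
  constructor
  · rintro ⟨⟨hx, -⟩, hxy⟩; exact ⟨hx, hxy⟩
  · rintro ⟨hx, hxy⟩; exact ⟨⟨hx, hxy ▸ hy⟩, hxy⟩

/-- `|T| = Σ_y #{x ∈ T | v x = y}`. [folklore] -/
theorem card_eq_sumT (T : Finset α) : T.card = ∑ y : PtT, (T.filter fun x => v x = y).card := by
  rw [← card_filter_mem_eq_sumT v T univ]
  congr 1
  ext x
  simp

/-- A sum over the model, expanded by slots. [folklore] -/
theorem sum_ptT (N : PtT → ℕ) : ∑ y : PtT, N y =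
    N (Sum.inl true) + N (Sum.inl false) + ∑ m : Fin 3, ∑ a : Fin 5, (N (Sum.inr (m, (a, true))) + N (Sum.inr (m, (a, false)))) := by
  rw [Fintype.sum_sum_type, Fintype.sum_bool, Fintype.sum_prod_type]
  simp only [Fintype.sum_prod_type, Fintype.sum_bool]

/-- The sum over `phiT c r`, expanded. [folklore] -/
theorem sum_phiT (c : Fin 8) (r : Fin 60) (N : PtT → ℕ) :
    ∑ y ∈ phiT c r, N y = N (Sum.inl true) + ∑ m : Fin 3, ∑ a : Fin 5, N (Sum.inr (m, (a, signTabT c r m a))) := by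
  rw [phiT_eq c r]
  have hinj : Function.Injective fun q : Fin 3 × Fin 5 => (Sum.inr (q.1, (q.2, signTabT c r q.1 q.2)) : PtT) := by
    rintro ⟨m, a⟩ ⟨m', a'⟩ h
    simp only [Sum.inr.injEq, Prod.mk.injEq] at h
    obtain ⟨rfl, rfl, -⟩ := h
    rfl
  have h1 : Sum.inl true ∉ (univ : Finset (Fin 3 × Fin 5)).image
      fun q => (Sum.inr (q.1, (q.2, signTabT c r q.1 q.2)) : PtT) := by simp
  rw [Finset.sum_insert h1, Finset.sum_image fun q _ q' _ h => hinj h, Fintype.sum_prod_type]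

/-- **The signed form of the `r`-th balance equation**: `2 Σ_{y ∈ phiT c r} N y = Σ_y N y` iff
`(N t − N f) + Σ_{m,a} ± (N(m,a,t) − N(m,a,f)) = 0`, the sign being `+` iff `signTabT c r m a`. [cite: GaoUllmo2025, Thm 3.1] -/
theorem balancedT_iff_signed (c : Fin 8) (r : Fin 60) (N : PtT → ℕ) :
    2 * ∑ y ∈ phiT c r, N y = ∑ y : PtT, N y ↔
      ((N (Sum.inl true) : ℤ) - N (Sum.inl false)) + ∑ m : Fin 3, ∑ a : Fin 5,
        (if signTabT c r m a then ((N (Sum.inr (m, (a, true))) : ℤ) - N (Sum.inr (m, (a, false))))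
          else -(((N (Sum.inr (m, (a, true))) : ℤ) - N (Sum.inr (m, (a, false)))))) = 0 := by
  rw [sum_phiT, sum_ptT]
  have key : ∀ m a, (2 * (N (Sum.inr (m, (a, signTabT c r m a))) : ℤ)) =
      ((N (Sum.inr (m, (a, true))) : ℤ) + N (Sum.inr (m, (a, false)))) +
        (if signTabT c r m a then ((N (Sum.inr (m, (a, true))) : ℤ) - N (Sum.inr (m, (a, false))))
          else -(((N (Sum.inr (m, (a, true))) : ℤ) - N (Sum.inr (m, (a, false)))))) := by
    intro m a
    cases signTabT c r m a <;> simp <;> ring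
  have hsum : (2 * (∑ m : Fin 3, ∑ a : Fin 5, N (Sum.inr (m, (a, signTabT c r m a)))) : ℤ) =
      (∑ m : Fin 3, ∑ a : Fin 5, (((N (Sum.inr (m, (a, true))) : ℤ) + N (Sum.inr (m, (a, false)))))) +
        ∑ m : Fin 3, ∑ a : Fin 5,
          (if signTabT c r m a then ((N (Sum.inr (m, (a, true))) : ℤ) - N (Sum.inr (m, (a, false))))
            else -(((N (Sum.inr (m, (a, true))) : ℤ) - N (Sum.inr (m, (a, false)))))) := by
    push_cast
    rw [Finset.mul_sum, ← Finset.sum_add_distrib]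
    refine Finset.sum_congr rfl fun m _ => ?_
    rw [Finset.mul_sum, ← Finset.sum_add_distrib]
    refine Finset.sum_congr rfl fun a _ => ?_
    exact key m a
  constructor
  · intro h
    have hz : (2 : ℤ) * ((N (Sum.inl true) : ℤ) + ((∑ m : Fin 3, ∑ a : Fin 5, N (Sum.inr (m, (a, signTabT c r m a))) : ℕ) : ℤ)) =
        (N (Sum.inl true) : ℤ) + N (Sum.inl false) +
          ((∑ m : Fin 3, ∑ a : Fin 5, (N (Sum.inr (m, (a, true))) + N (Sum.inr (m, (a, false)))) : ℕ) : ℤ) := by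
      exact_mod_cast h
    push_cast at hz hsum
    linarith
  · intro h
    have hz : (2 : ℤ) * ((N (Sum.inl true) : ℤ) + ((∑ m : Fin 3, ∑ a : Fin 5, N (Sum.inr (m, (a, signTabT c r m a))) : ℕ) : ℤ)) =
        (N (Sum.inl true) : ℤ) + N (Sum.inl false) +
          ((∑ m : Fin 3, ∑ a : Fin 5, (N (Sum.inr (m, (a, true))) + N (Sum.inr (m, (a, false)))) : ℕ) : ℤ) := by
      push_cast at hsum ⊢
      linarith
    exact_mod_cast hz

end Summit.HodgeConjecture.CorCM.Census.DecicWeil23Triple
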